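import Summits.ResolutionOfSingularities.ResolutionOfSingularities.Theorems.FrobeniusLadderFInjectiveMacaulayficationOfFullBlowupGe4
import Summits.ResolutionOfSingularities.ResolutionOfSingularities.Theorems.FrobeniusLadderFInjectiveMacaulayficationFTemkinClosedPointsAdm
import Summits.ResolutionOfSingularities.ResolutionOfSingularities.Theorems.FrobeniusLadderFInjectiveMacaulayficationRegularOffFiniteOfLRAdm
import Summits.ResolutionOfSingularities.ResolutionOfSingularities.Theorems.FrobeniusLadderFInjectiveMacaulayficationRegularOffFiniteOfLRFibre
import Summits.ResolutionOfSingularities.ResolutionOfSingularities.Theorems.FrobeniusLadderFInjectiveMacaulayficationLocalFullificationFibreAdmGe4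
import Summits.ResolutionOfSingularities.ResolutionOfSingularities.Theorems.FrobeniusLadderFInjectiveMacaulayficationLocalFullificationFibreAdmGe4Split
import HarnessLib

/-!
# (AD3) THE ADMISSIBLE LOCAL DOOR: the crux `FInjectiveMacaulayfication` from {CP 2019 Thm. 1.1, Raynaud–Gruson, CP 2019 Prop. 4.4} ∧ (LR_adm) ∧ (LF_adm)
# (crux stmt-ResolutionOfSingularities-15315, chain w45a; res-L1-w45a-plan-1 RULING R17.8 programme «AD» — door v36.2's `_proof` term: both registered local
# statements restricted to X_reg-ADMISSIBLE local blow-ups (`supp I ⊆ (Reg Spec 𝒪_{X,x})ᶜ`), Temkin 2008 Prop. 2.3.4 (iii)'s category; seat res-L1-w45a-stub-1 g7)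

[OURS · L1 W4.5a] Support file (`--supports stmt-ResolutionOfSingularities-15315 --as helper`); replaces the role of NO printed item; NOT a statement of the
manuscript; def-free; THEOREMS modulo three printed results BY NAME (`CossartPiltant2019General`, `Stacks081R`, `CossartPiltant2019Principalization`) and the
chain's two CANDIDATE local statements in ADMISSIBLE form, consumed as hypotheses: (LR_adm) `RegularOffFiniteOfLRAdm.LocalResolutionNonClosedGe4Adm`
(res-L1-w45a-stub-3) and (LF_adm) `LocalFullificationFibreAdmGe4.LocalFullificationFibreAdmGe4` (res-L1-w45a-stub-2). AI-written (AI review is weaker than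
expert review).

* `fullBlowupGe4_of_localDoorAdm`, `fiModel_integral_of_localDoorAdm`, `fInjectiveMacaulayfication_text_of_localDoorAdm`, and
  **`fInjectiveMacaulayfication_of_localDoorAdm (hG h081R hP) (hLR : LocalResolutionNonClosedGe4Adm) (hLF : LocalFullificationFibreAdmGe4) : route decl`** —
  engine: res-L1-w45a-stub-3's THEOREM A-gen-adm `RegularOffFiniteOfLRAdm.regularOffFinite_of_LRadm` fed to res-L1-w45a-stub-2's admissible F-Temkin
  `FTemkinClosedPointsAdm.exists_isBlowup_full_of_LFadm_of_regularOffFinite`, packaged by `OfFullBlowupGe4`.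
* `…_of_localDoorAdmF` — the same with (LR♭) `RegularOffFiniteOfLRFibre.LocalResolutionNonClosedGe4Fibre` in place of (LR_adm) (one-liners through
  `RegularOffFiniteOfLRAdm.localResolutionNonClosedGe4Adm_of_fibre`).
[folklore assembly; cite: CossartPiltant2019, Thm. 1.1 (i)(ii); Prop. 4.4] [cite: RaynaudGruson1971, Thm. 5.2.2] [cite: Temkin2008, Prop. 2.3.4 (iii); Lemma 2.1.1]
-/

-- single-problem summit: the doubled namespace component is forced
set_option linter.dupNamespace false

noncomputable section

namespace Summit.ResolutionOfSingularities.ResolutionOfSingularities.Theorems.FInjectiveMacaulayfication.OfLocalDoorAdm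

open CategoryTheory CategoryTheory.Limits AlgebraicGeometry TopologicalSpace IsLocalRing
open Literature.AlgebraicGeometry.Resolution
open Summit.ResolutionOfSingularities.ResolutionOfSingularities.Theorems.FInjectiveMacaulayfication
open SliceableCentre

/-! ## §1 (LR_adm) × (LF_adm) -/

/-- The ADMISSIBLE local door supplies the FULL blow-up model in dimension `≥ 4` (the input shape of `OfFullBlowupGe4`). [OURS · conditional-result]
[cite: Temkin2008, Prop. 2.3.4 (iii)] [cite: CossartPiltant2019, Thm. 1.1 (i)(ii); Prop. 4.4] -/
theorem fullBlowupGe4_of_localDoorAdm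
    (hG : CossartPiltant2019General.{0}) (h081R : Stacks081R.{0}) (hP : CossartPiltant2019Principalization.{0})
    (hLR : RegularOffFiniteOfLRAdm.LocalResolutionNonClosedGe4Adm) (hLF : LocalFullificationFibreAdmGe4.LocalFullificationFibreAdmGe4)
    (p : ℕ) (hp : p.Prime) :
    ∀ (k : Type) [Field k] [CharP k p] (X : Scheme.{0}) (f : X ⟶ Spec (.of k)),
      IsSeparated f → LocallyOfFiniteType f → QuasiCompact f → IsIntegral X → (4 : WithBot ℕ∞) ≤ topologicalKrullDim X →
      ∃ (X'' : Scheme.{0}) (f'' : X'' ⟶ X) (J'' : X.IdealSheafData), IsBlowup f'' J'' ∧ J'' ≠ ⊥ ∧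
        ∀ x'' : X'', FullCl p (X''.presheaf.stalk x'') := by
  intro k _ _ X f hs hl hq hi hd
  haveI := hs
  haveI := hl
  haveI := hq
  haveI := hi
  have h3 : (3 : WithBot ℕ∞) ≤ topologicalKrullDim X := le_trans (by norm_num) hd
  obtain ⟨X'', f'', J'', hf'', hJ'', -, hfull⟩ :=
    FTemkinClosedPointsAdm.exists_isBlowup_full_of_LFadm_of_regularOffFinite (fun d h => hLF d h) p hp k X f hd
      (RegularOffFiniteOfLRAdm.regularOffFinite_of_LRadm hG h081R hP hLR p hp k X f h3)
  exact ⟨X'', f'', J'', hf'', hJ'', hfull⟩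

/-- **The crux's INTEGRAL FORM from the admissible local door.** [OURS · conditional-result]
[cite: CossartPiltant2019, Thm. 1.1 (i)(ii); Prop. 4.4] [cite: Temkin2008, Prop. 2.3.4 (iii)] -/
theorem fiModel_integral_of_localDoorAdm
    (hG : CossartPiltant2019General.{0}) (h081R : Stacks081R.{0}) (hP : CossartPiltant2019Principalization.{0})
    (hLR : RegularOffFiniteOfLRAdm.LocalResolutionNonClosedGe4Adm) (hLF : LocalFullificationFibreAdmGe4.LocalFullificationFibreAdmGe4)
    (p : ℕ) [hp : Fact p.Prime] (k : Type) [Field k] [CharP k p] (X : Scheme.{0}) (f : X ⟶ Spec (.of k))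
    [IsSeparated f] [LocallyOfFiniteType f] [QuasiCompact f] [IsIntegral X] :
    ∃ (X' : Scheme.{0}) (π : X' ⟶ X), IsProper π ∧ IsBirational π ∧ IsIntegral X' ∧ ∀ x : X', FullCl p (X'.presheaf.stalk x) :=
  OfFullBlowupGe4.fiModel_integral_of_fullBlowupGe4 hG p (fullBlowupGe4_of_localDoorAdm hG h081R hP hLR hLF p hp.out) k X f

/-- **★ THE CRUX'S ∀-TEXT VERBATIM from the admissible local door.** [OURS · conditional-result]
[cite: CossartPiltant2019, Thm. 1.1 (i)(ii); Prop. 4.4] [cite: Temkin2008, Prop. 2.3.4 (iii)] -/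
theorem fInjectiveMacaulayfication_text_of_localDoorAdm
    (hG : CossartPiltant2019General.{0}) (h081R : Stacks081R.{0}) (hP : CossartPiltant2019Principalization.{0})
    (hLR : RegularOffFiniteOfLRAdm.LocalResolutionNonClosedGe4Adm) (hLF : LocalFullificationFibreAdmGe4.LocalFullificationFibreAdmGe4) :
    ∀ p : ℕ, p.Prime → ∀ (k : Type) [Field k] [CharP k p] (X : Scheme.{0}) (f : X ⟶ Spec (.of k)),
      IsSeparated f → LocallyOfFiniteType f → QuasiCompact f → IsReduced X →
      ∃ (X' : Scheme.{0}) (π : X' ⟶ X), IsProper π ∧ IsBirational π ∧ ∀ x : X',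
        IsDomain (X'.presheaf.stalk x) ∧ ∀ d : ℕ, ringKrullDim (X'.presheaf.stalk x) = d →
          ∀ s : Fin d → X'.presheaf.stalk x, (Ideal.span (Set.range s)).radical.IsMaximal →
            RingTheory.Sequence.IsWeaklyRegular (X'.presheaf.stalk x) (List.ofFn s) ∧
            ∀ y : X'.presheaf.stalk x, (∃ e : ℕ, y ^ p ^ e ∈ Ideal.span
              ((fun z : X'.presheaf.stalk x => z ^ p ^ e) ''
                (Ideal.span (Set.range s) : Set (X'.presheaf.stalk x)))) →
              y ∈ Ideal.span (Set.range s) :=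
  OfFullBlowupGe4.fInjectiveMacaulayfication_text_of_fullBlowupGe4 hG
    (fun p hp => fullBlowupGe4_of_localDoorAdm hG h081R hP hLR hLF p hp)

/-- **★★★ THE ROUTE DECL `Theses.FrobeniusLadder.FInjectiveMacaulayfication` FROM THE ADMISSIBLE LOCAL DOOR** {CP 1.1, 081R, CP 4.4} ∧ (LR_adm) ∧ (LF_adm)
— door v36.2's `_proof` term (registered stubs `stub_localResolutionNonClosedGe4Adm`, `stub_localFullificationFibreAdmGe4`). [OURS · conditional-result]
[cite: CossartPiltant2019, Thm. 1.1 (i)(ii); Prop. 4.4] [cite: RaynaudGruson1971, Thm. 5.2.2] [cite: Temkin2008, Prop. 2.3.4 (iii)] -/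
theorem fInjectiveMacaulayfication_of_localDoorAdm
    (hG : CossartPiltant2019General.{0}) (h081R : Stacks081R.{0}) (hP : CossartPiltant2019Principalization.{0})
    (hLR : RegularOffFiniteOfLRAdm.LocalResolutionNonClosedGe4Adm) (hLF : LocalFullificationFibreAdmGe4.LocalFullificationFibreAdmGe4) :
    Summit.ResolutionOfSingularities.ResolutionOfSingularities.Theses.FrobeniusLadder.FInjectiveMacaulayfication :=
  OfFullBlowupGe4.fInjectiveMacaulayfication_of_fullBlowupGe4 hG (fun p hp => fullBlowupGe4_of_localDoorAdm hG h081R hP hLR hLF p hp)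

/-! ## §2 (LR♭) × (LF_adm) — one-liners through `localResolutionNonClosedGe4Adm_of_fibre` -/

/-- **The crux's INTEGRAL FORM from (LR♭) ∧ (LF_adm).** [OURS · conditional-result] [cite: Temkin2008, Prop. 2.3.4 (iii)] -/
theorem fiModel_integral_of_localDoorAdmF
    (hG : CossartPiltant2019General.{0}) (h081R : Stacks081R.{0}) (hP : CossartPiltant2019Principalization.{0})
    (hLR : RegularOffFiniteOfLRFibre.LocalResolutionNonClosedGe4Fibre) (hLF : LocalFullificationFibreAdmGe4.LocalFullificationFibreAdmGe4)
    (p : ℕ) [Fact p.Prime] (k : Type) [Field k] [CharP k p] (X : Scheme.{0}) (f : X ⟶ Spec (.of k))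
    [IsSeparated f] [LocallyOfFiniteType f] [QuasiCompact f] [IsIntegral X] :
    ∃ (X' : Scheme.{0}) (π : X' ⟶ X), IsProper π ∧ IsBirational π ∧ IsIntegral X' ∧ ∀ x : X', FullCl p (X'.presheaf.stalk x) :=
  fiModel_integral_of_localDoorAdm hG h081R hP (RegularOffFiniteOfLRAdm.localResolutionNonClosedGe4Adm_of_fibre hLR) hLF p k X f

/-- **★★ THE ROUTE DECL from (LR♭) ∧ (LF_adm).** [OURS · conditional-result] [cite: Temkin2008, Prop. 2.3.4 (iii)]
[cite: CossartPiltant2019, Thm. 1.1 (i)(ii); Prop. 4.4] -/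
theorem fInjectiveMacaulayfication_of_localDoorAdmF
    (hG : CossartPiltant2019General.{0}) (h081R : Stacks081R.{0}) (hP : CossartPiltant2019Principalization.{0})
    (hLR : RegularOffFiniteOfLRFibre.LocalResolutionNonClosedGe4Fibre) (hLF : LocalFullificationFibreAdmGe4.LocalFullificationFibreAdmGe4) :
    Summit.ResolutionOfSingularities.ResolutionOfSingularities.Theses.FrobeniusLadder.FInjectiveMacaulayfication :=
  fInjectiveMacaulayfication_of_localDoorAdm hG h081R hP (RegularOffFiniteOfLRAdm.localResolutionNonClosedGe4Adm_of_fibre hLR) hLF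

/-! ## §3 Door v37's pre-authorised shape (programme «CZ»; res-L1-w45a-plan-1 GO 01:14:44Z): the CM-half of (LF_adm) from [Česnavičius 2021, Thm. 5.3]
as the BINDER `hM` (text = the `hM` of `LocalFullificationFibreAdmGe4Split.localFullificationFibreAdmGe4_of_fact_of_F`, = the FACT-REQUEST text
`CesnaviciusBlowupMacaulayfication`; NOT a Literature fact until the desk admits it), so that only the F-half (LF_adm-F)
`LocalFullificationFibreAdmGe4Split.LocalFInjectivizationFibreAdmGe4` remains on the F-side. One-liners through
`LocalFullificationFibreAdmGe4Split.localFullificationFibreAdmGe4_of_fact_of_F` (res-L1-w45a-stub-2). Seat res-L1-w45a-stub-1 g8. -/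

/-- **The crux's INTEGRAL FORM from {CP 1.1, 081R, CP 4.4} ∧ [Česnavičius 2021, Thm. 5.3 as the binder `hM`] ∧ (LR_adm) ∧ (LF_adm-F).**
[OURS · conditional-result: conditional on the Česnavičius text AS TYPED in `hM` and on the two CANDIDATE local statements]
[cite: Cesnavicius2021, Thm. 5.3] [cite: CossartPiltant2019, Thm. 1.1 (i)(ii); Prop. 4.4] [cite: Temkin2008, Prop. 2.3.4 (iii)] -/
theorem fiModel_integral_of_localDoorAdm_of_fact
    (hG : CossartPiltant2019General.{0}) (h081R : Stacks081R.{0}) (hP : CossartPiltant2019Principalization.{0})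
    (hM : ∀ (Y : Scheme.{0}) [IsIntegral Y] [IsNoetherian Y], Scheme.IsExcellent Y →
      ∃ Z : Y.IdealSheafData,
        (∀ y : Y, y ∈ (Z.support : Set Y) →
          ¬ (∀ d : ℕ, ringKrullDim (Y.presheaf.stalk y) = d →
              ∀ s : Fin d → Y.presheaf.stalk y, (Ideal.span (Set.range s)).radical.IsMaximal →
                RingTheory.Sequence.IsWeaklyRegular (Y.presheaf.stalk y) (List.ofFn s))) ∧
        ∀ (Y' : Scheme.{0}) (π : Y' ⟶ Y), IsBlowup π Z →
          ∀ y' : Y', ∀ d : ℕ, ringKrullDim (Y'.presheaf.stalk y') = d →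
            ∀ s : Fin d → Y'.presheaf.stalk y', (Ideal.span (Set.range s)).radical.IsMaximal →
              RingTheory.Sequence.IsWeaklyRegular (Y'.presheaf.stalk y') (List.ofFn s))
    (hLR : RegularOffFiniteOfLRAdm.LocalResolutionNonClosedGe4Adm)
    (hF : LocalFullificationFibreAdmGe4Split.LocalFInjectivizationFibreAdmGe4)
    (p : ℕ) [Fact p.Prime] (k : Type) [Field k] [CharP k p] (X : Scheme.{0}) (f : X ⟶ Spec (.of k))
    [IsSeparated f] [LocallyOfFiniteType f] [QuasiCompact f] [IsIntegral X] :
    ∃ (X' : Scheme.{0}) (π : X' ⟶ X), IsProper π ∧ IsBirational π ∧ IsIntegral X' ∧ ∀ x : X', FullCl p (X'.presheaf.stalk x) :=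
  fiModel_integral_of_localDoorAdm hG h081R hP hLR
    (LocalFullificationFibreAdmGe4Split.localFullificationFibreAdmGe4_of_fact_of_F hM hF) p k X f

/-- **★★★ THE ROUTE DECL `Theses.FrobeniusLadder.FInjectiveMacaulayfication` from {CP 1.1, 081R, CP 4.4} ∧ [Česnavičius 2021, Thm. 5.3 as the binder `hM`]
∧ (LR_adm) ∧ (LF_adm-F)** — door v37's pre-authorised `_proof` term
(`_proof := OfLocalDoorAdm.fInjectiveMacaulayfication_of_localDoorAdm_of_fact <hG> <h081R> <hP> <hM> stub_localResolutionNonClosedGe4Adm stub_localFInjectivizationFibreAdmGe4`;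
the binder `hM` unfolds from the Literature def once the desk admits the fact). The registered F-side residue is then the F-half alone.
[OURS · conditional-result: conditional on the Česnavičius text AS TYPED in `hM` and on the two CANDIDATE local statements]
[cite: Cesnavicius2021, Thm. 5.3] [cite: CossartPiltant2019, Thm. 1.1 (i)(ii); Prop. 4.4] [cite: RaynaudGruson1971, Thm. 5.2.2]
[cite: Temkin2008, Prop. 2.3.4 (iii)] -/
theorem fInjectiveMacaulayfication_of_localDoorAdm_of_fact
    (hG : CossartPiltant2019General.{0}) (h081R : Stacks081R.{0}) (hP : CossartPiltant2019Principalization.{0})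
    (hM : ∀ (Y : Scheme.{0}) [IsIntegral Y] [IsNoetherian Y], Scheme.IsExcellent Y →
      ∃ Z : Y.IdealSheafData,
        (∀ y : Y, y ∈ (Z.support : Set Y) →
          ¬ (∀ d : ℕ, ringKrullDim (Y.presheaf.stalk y) = d →
              ∀ s : Fin d → Y.presheaf.stalk y, (Ideal.span (Set.range s)).radical.IsMaximal →
                RingTheory.Sequence.IsWeaklyRegular (Y.presheaf.stalk y) (List.ofFn s))) ∧
        ∀ (Y' : Scheme.{0}) (π : Y' ⟶ Y), IsBlowup π Z →
          ∀ y' : Y', ∀ d : ℕ, ringKrullDim (Y'.presheaf.stalk y') = d →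
            ∀ s : Fin d → Y'.presheaf.stalk y', (Ideal.span (Set.range s)).radical.IsMaximal →
              RingTheory.Sequence.IsWeaklyRegular (Y'.presheaf.stalk y') (List.ofFn s))
    (hLR : RegularOffFiniteOfLRAdm.LocalResolutionNonClosedGe4Adm)
    (hF : LocalFullificationFibreAdmGe4Split.LocalFInjectivizationFibreAdmGe4) :
    Summit.ResolutionOfSingularities.ResolutionOfSingularities.Theses.FrobeniusLadder.FInjectiveMacaulayfication :=
  fInjectiveMacaulayfication_of_localDoorAdm hG h081R hP hLR
    (LocalFullificationFibreAdmGe4Split.localFullificationFibreAdmGe4_of_fact_of_F hM hF)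

end Summit.ResolutionOfSingularities.ResolutionOfSingularities.Theorems.FInjectiveMacaulayfication.OfLocalDoorAdm

end
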